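import Mathlib

/-!
# AtomicCalibrationR (stmt-QuantumFields-28169), E2 `stub_offDiagonalWhitney` — Leibniz bound for a flat function times a bump
# (Plan A steps 4–5 of planner ym-idea-11 g15's `STUB-PLAN-offDiagonalWhitney.md`; prover w4 g22, free hands)

The derivative estimate that turns the flatness of an off-diagonal `F` near the coincidence locus
(`‖D^j F(z)‖ ≤ P r^{K−j}`, `AtomicCalibrationRDistFat` / `…OffDiagonalFlatness`) and the scale-`s` bump bounds
(`‖D^i Φ(z)‖ ≤ Q s^{−i}`, `AtomicCalibrationRProductBump`) into the `M_j / ρ_j^m` clause of `WhitneyPkg`: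

* `norm_iteratedFDeriv_mul_le_of_flat` — `‖D^m (F·Φ)(z)‖ ≤ P Q (1 + r/s)^m r^{K−m}` (`m ≤ K`), by Mathlib's
  `norm_iteratedFDeriv_mul_le` and the binomial theorem;
* `norm_iteratedFDeriv_mul_le_of_flat'` — the same repackaged as `≤ (P Q (1 + r/s)^m r^K) / s^m` when `s ≤ r`
  (the Whitney regime `ρ ≤ dist`), i.e. literally `M / ρ^m` with `M = P Q (1 + r/s)^m r^K`.

Mathlib only; no stub/crux/rung/summit is closed; nothing here touches Yang–Mills; the YM mass gap is NOT proved. [folklore]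
-/

set_option autoImplicit false

noncomputable section

open scoped BigOperators ContDiff

namespace Summit.QuantumFields.YangMills.Cruxes.AtomicCalibrationR.FlatLeibniz

variable {E : Type*} [NormedAddCommGroup E] [NormedSpace ℝ E] {A : Type*} [NormedRing A] [NormedAlgebra ℝ A]

/-- The binomial bookkeeping: `Σ_{i ≤ m} C(m,i) (P r^{K−i}) (Q s^{−(m−i)}) = P Q (1 + r/s)^m r^{K−m}` for `m ≤ K`. -/
theorem sum_choose_flat_eq {m K : ℕ} (hmK : m ≤ K) (P Q r s : ℝ) :
    ∑ i ∈ Finset.range (m + 1), (m.choose i : ℝ) * (P * r ^ (K - i)) * (Q * s⁻¹ ^ (m - i)) =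
      P * Q * (1 + r / s) ^ m * r ^ (K - m) := by
  rw [add_pow, Finset.mul_sum, Finset.sum_mul]
  refine Finset.sum_congr rfl fun i hi => ?_
  have him : i ≤ m := Nat.lt_succ_iff.1 (Finset.mem_range.1 hi)
  have hK : K - i = (K - m) + (m - i) := by omega
  rw [hK, pow_add, div_eq_mul_inv, mul_pow, one_pow, one_mul]
  ring

/-- **Leibniz bound for a flat function times a bump.**  If at `z` the factors of a product of `C^∞` functions satisfy
`‖D^j F(z)‖ ≤ P r^{K−j}` and `‖D^i Φ(z)‖ ≤ Q s^{−i}` for all orders `≤ m` (`m ≤ K`, `r ≥ 0`), then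
`‖D^m (F Φ)(z)‖ ≤ P Q (1 + r/s)^m r^{K−m}`. [folklore] -/
theorem norm_iteratedFDeriv_mul_le_of_flat {F Φ : E → A} (hF : ContDiff ℝ ∞ F) (hΦ : ContDiff ℝ ∞ Φ) {m K : ℕ}
    (hmK : m ≤ K) {P Q r s : ℝ} (hP : 0 ≤ P) (hr : 0 ≤ r) (z : E)
    (hFb : ∀ j : ℕ, j ≤ m → ‖iteratedFDeriv ℝ j F z‖ ≤ P * r ^ (K - j))
    (hΦb : ∀ i : ℕ, i ≤ m → ‖iteratedFDeriv ℝ i Φ z‖ ≤ Q * s⁻¹ ^ i) :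
    ‖iteratedFDeriv ℝ m (fun x => F x * Φ x) z‖ ≤ P * Q * (1 + r / s) ^ m * r ^ (K - m) := by
  have h1 := norm_iteratedFDeriv_mul_le (𝕜 := ℝ) (N := (⊤ : ℕ∞)) hF hΦ z (n := m) (by exact_mod_cast le_top)
  refine h1.trans ?_
  rw [← sum_choose_flat_eq hmK P Q r s]
  refine Finset.sum_le_sum fun i hi => ?_
  have him : i ≤ m := Nat.lt_succ_iff.1 (Finset.mem_range.1 hi)
  have hFi := hFb i him
  have hΦi := hΦb (m - i) (Nat.sub_le m i)
  have h0 : 0 ≤ P * r ^ (K - i) := mul_nonneg hP (pow_nonneg hr _)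
  calc (m.choose i : ℝ) * ‖iteratedFDeriv ℝ i F z‖ * ‖iteratedFDeriv ℝ (m - i) Φ z‖
      ≤ (m.choose i : ℝ) * (P * r ^ (K - i)) * (Q * s⁻¹ ^ (m - i)) := by
        refine mul_le_mul (mul_le_mul_of_nonneg_left hFi (Nat.cast_nonneg _)) hΦi (norm_nonneg _) ?_
        exact mul_nonneg (Nat.cast_nonneg _) h0

/-- **Whitney form** of the previous bound: for `0 < s ≤ r` (piece scale below the distance scale) the estimate reads
`‖D^m (F Φ)(z)‖ ≤ (P Q (1 + r/s)^m r^K) / s^m` — the `M / ρ^m` clause of `WhitneyPkg` with `ρ = s`. [folklore] -/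
theorem norm_iteratedFDeriv_mul_le_of_flat' {F Φ : E → A} (hF : ContDiff ℝ ∞ F) (hΦ : ContDiff ℝ ∞ Φ) {m K : ℕ}
    (hmK : m ≤ K) {P Q r s : ℝ} (hP : 0 ≤ P) (hQ : 0 ≤ Q) (hs : 0 < s) (hsr : s ≤ r) (z : E)
    (hFb : ∀ j : ℕ, j ≤ m → ‖iteratedFDeriv ℝ j F z‖ ≤ P * r ^ (K - j))
    (hΦb : ∀ i : ℕ, i ≤ m → ‖iteratedFDeriv ℝ i Φ z‖ ≤ Q * s⁻¹ ^ i) :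
    ‖iteratedFDeriv ℝ m (fun x => F x * Φ x) z‖ ≤ P * Q * (1 + r / s) ^ m * r ^ K / s ^ m := by
  have hr : 0 ≤ r := hs.le.trans hsr
  have h1 := norm_iteratedFDeriv_mul_le_of_flat hF hΦ hmK hP hr z hFb hΦb
  refine h1.trans ?_
  rw [le_div_iff₀ (pow_pos hs m)]
  have hK : r ^ K = r ^ (K - m) * r ^ m := by rw [← pow_add, Nat.sub_add_cancel hmK]
  rw [hK]
  have hC : 0 ≤ P * Q * (1 + r / s) ^ m := mul_nonneg (mul_nonneg hP hQ) (pow_nonneg (by positivity) _)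
  have hsm : s ^ m ≤ r ^ m := pow_le_pow_left₀ hs.le hsr m
  calc P * Q * (1 + r / s) ^ m * r ^ (K - m) * s ^ m
      ≤ P * Q * (1 + r / s) ^ m * r ^ (K - m) * r ^ m :=
        mul_le_mul_of_nonneg_left hsm (mul_nonneg hC (pow_nonneg hr _))
    _ = P * Q * (1 + r / s) ^ m * (r ^ (K - m) * r ^ m) := by ring

end Summit.QuantumFields.YangMills.Cruxes.AtomicCalibrationR.FlatLeibniz

end
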